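import Mathlib.Algebra.Order.BigOperators.Group.Finset
import Literature.NumberTheory.LFunctions.MoebiusAutomaticSynchronizing
import HarnessLib

/-!
# Müllner's theorem, Prop. 3.3 for a trivial transducer group: preparations (proved)

Everything in this file is PROVED. It prepares the formalisation of the reduction
Prop. 3.2 ⇒ Thm. 1.2 of C. Müllner, *Automatic sequences fulfill the Sarnak conjecture* (Duke
Math. J. 166 (2017)), §3.1, in the case where every final component of the automaton is
synchronizing (all naturally induced transducers trivial, `G = {id}`), for the named fact
`Literature.NumberTheory.LFunctions.mullner_moebius_automatic`:

* `μ` on (interval ∩ arithmetic progression), uniformly in the interval inside `[0, N]`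
  (`exists_forall_norm_sum_range_indicator_mul_moebius_le`, from
  `isLittleO_moebiusSum_residueClass`) — the input "estimates for the Möbius function along
  arithmetic progressions" once the first AND last digits are fixed (Müllner §3.1, sums `S₂`, `S₃`
  with `D` trivial);
* the density-one lemma for prefixes entering the closed set `F` of final states (Müllner,
  Lemma "setDens", §5.1, eq. (number_paths_strongly_connected)): `enterBad`,
  `card_enterBad_mul_le` (`#{b < k^{mt} : δ(q₀,(b)_k^{mt}) ∉ F} ≤ (k^m − 1)^t` when every
  state enters `F` by a word of length `m`; the proportion then tends to `0` by
  `exists_card_le_of_card_mul_le` of `MoebiusAutomaticSynchronizing.lean`);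
* leading zeros (`foldl_msbBlock_eq_of_fix_zero`: with `δ(q₀,0) = q₀` the padded word `(n)_k^ν`
  and `(n)_k` lead to the same state) and the normalisation `dfaoSeq_optionLift`
  (every DFAO sequence is generated by a DFAO with `δ(q₀, 0) = q₀`; Müllner Cor. 2.26 /
  Allouche–Shallit Thm. 5.2.1).

## References
* C. Müllner, Duke Math. J. 166 (2017), §3.1 (Prop. 3.3) and §5.1. [Mullner2017]
-/

noncomputable section

open Finset Filter Asymptotics
open scoped ArithmeticFunction.Moebius

namespace Literature.NumberTheory.LFunctions

/-! ## `μ` on intervals in progressions, uniformly -/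

/-- **Uniform smallness of all initial segments.** If `∑_{n ≤ N} e(n) μ(n) = o(N)` and `|e| ≤ 1`
then for every `ε > 0`, for all large `N`, EVERY initial segment `∑_{n < y} e(n) μ(n)` with
`y ≤ N + 1` is at most `ε N` (short segments trivially, long ones by hypothesis). [folklore] -/
theorem exists_forall_norm_sum_range_le {e : ℕ → ℂ}
    (he : moebiusSum e =o[atTop] fun N : ℕ => (N : ℝ)) (hb : ∀ n, ‖e n‖ ≤ 1) {ε : ℝ}
    (hε : 0 < ε) : ∃ N₀ : ℕ, ∀ N : ℕ, N₀ ≤ N → ∀ y : ℕ, y ≤ N + 1 →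
      ‖∑ n ∈ range y, e n * (μ n : ℂ)‖ ≤ ε * N := by
  obtain ⟨N₁, hN₁⟩ := eventually_atTop.1 (he.def hε)
  obtain ⟨N₂, hN₂⟩ := exists_nat_gt ((N₁ : ℝ) / ε)
  refine ⟨max N₁ N₂, fun N hN y hy => ?_⟩
  have hN1 : N₁ ≤ N := (le_max_left _ _).trans hN
  have hN2 : (N₁ : ℝ) ≤ ε * N := by
    have : (N₁ : ℝ) / ε ≤ N := hN₂.le.trans (by exact_mod_cast (le_max_right _ _).trans hN)
    rwa [div_le_iff₀ hε, mul_comm] at this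
  rcases y with _ | M
  · simp only [range_zero, sum_empty, norm_zero]; positivity
  · rcases le_or_gt N₁ M with hM | hM
    · have h := hN₁ M hM
      rw [Real.norm_natCast] at h
      have hMN : (M : ℝ) ≤ N := by exact_mod_cast Nat.le_of_lt_succ (Nat.lt_of_succ_le hy)
      calc ‖∑ n ∈ range (M + 1), e n * (μ n : ℂ)‖ = ‖moebiusSum e M‖ := rfl
        _ ≤ ε * M := h
        _ ≤ ε * N := by gcongr
    · calc ‖∑ n ∈ range (M + 1), e n * (μ n : ℂ)‖ ≤ ∑ n ∈ range (M + 1), ‖e n‖ :=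
            norm_moebiusSum_le e M
        _ ≤ ∑ _n ∈ range (M + 1), (1 : ℝ) := sum_le_sum fun n _ => hb n
        _ = M + 1 := by simp
        _ ≤ N₁ := by exact_mod_cast hM
        _ ≤ ε * N := hN2

/-- **`μ` on an interval inside a residue class** (the sums left once the first `λ₁` and the last
`λ₂` digits are fixed, Müllner §3.1 with trivial `D`): for `q ≥ 1`, `ε > 0` and all large `N`,
`|∑_{x ≤ n < y, n ≡ m (q)} μ(n)| ≤ ε N` for ALL `x ≤ y ≤ N + 1` and all `m`.
[cite: Mullner2017, §3.1] -/
theorem exists_forall_norm_sum_Ico_residue_moebius_le {q : ℕ} (hq : 0 < q) {ε : ℝ} (hε : 0 < ε) :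
    ∃ N₀ : ℕ, ∀ N : ℕ, N₀ ≤ N → ∀ m x y : ℕ, y ≤ N + 1 →
      ‖∑ n ∈ Ico x y, (if n % q = m then (1 : ℂ) else 0) * (μ n : ℂ)‖ ≤ ε * N := by
  -- one `N₀` per residue `m < q`; residues `m ≥ q` give zero sums
  have hb : ∀ m n : ℕ, ‖(if n % q = m then (1 : ℂ) else 0)‖ ≤ 1 := by
    intro m n; split_ifs <;> simp
  choose N₀ hN₀ using fun m : ℕ =>
    exists_forall_norm_sum_range_le (isLittleO_moebiusSum_residueClass hq m) (hb m)
      (half_pos hε)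
  refine ⟨(range q).sup N₀, fun N hN m x y hy => ?_⟩
  rcases lt_or_ge y x with hyx | hxy
  · rw [Ico_eq_empty_of_le hyx.le, sum_empty, norm_zero]; positivity
  rcases lt_or_ge m q with hm | hm
  · have hNm : N₀ m ≤ N := (le_sup (f := N₀) (mem_range.2 hm)).trans hN
    rw [sum_Ico_eq_sub _ hxy]
    refine (norm_sub_le _ _).trans ?_
    have h1 := hN₀ m N hNm y hy
    have h2 := hN₀ m N hNm x (hxy.trans hy)
    linarith
  · have : ∀ n, (if n % q = m then (1 : ℂ) else 0) = 0 := fun n => by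
      rw [if_neg]; exact ((Nat.mod_lt n hq).trans_le hm).ne
    simp only [this, zero_mul, sum_const_zero, norm_zero]
    positivity

/-! ## Entering the set of final states: density of bad prefixes -/

section Enter

variable {σ : Type*}

/-- The prefixes `b < k^L` after which the automaton is NOT yet in `F`:
`{b < k^L : δ(q₀, (b)_k^L) ∉ F}` (the complement of Müllner's `M_{1,q₀}` at length `L`, §5.1).
[cite: Mullner2017, §5.1] -/
def enterBad (k : ℕ) (δ : σ → ℕ → σ) (q₀ : σ) (F : Set σ) (L : ℕ) : Finset ℕ := by
  classical exact (range (k ^ L)).filter fun b => (msbBlock k L b).foldl δ q₀ ∉ F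

/-- Membership in `enterBad`. [folklore] -/
theorem mem_enterBad {k : ℕ} {δ : σ → ℕ → σ} {q₀ : σ} {F : Set σ} {L b : ℕ} :
    b ∈ enterBad k δ q₀ F L ↔ b < k ^ L ∧ (msbBlock k L b).foldl δ q₀ ∉ F := by
  classical
  simp [enterBad]

/-- A set of states closed under the digit transitions stays put under words of digits.
[folklore] -/
theorem foldl_mem_of_closed {k : ℕ} {δ : σ → ℕ → σ} {F : Set σ}
    (hF : ∀ q ∈ F, ∀ d, d < k → δ q d ∈ F) {u : List ℕ} (hu : ∀ d ∈ u, d < k) {q : σ}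
    (hq : q ∈ F) : u.foldl δ q ∈ F := by
  induction u generalizing q with
  | nil => exact hq
  | cons d u ih =>
    exact ih (fun x hx => hu x (List.mem_cons_of_mem _ hx)) (hF q hq d (hu d (by simp)))

/-- **Uniform entering length** (Müllner §5.1: "we may assume that each of these paths is
exactly of length `m`"): if every state reaches the closed set `F` by some word of digits, then
there is `m` such that every state reaches `F` by a word of digits of length exactly `m`
(pad with zeros, `k ≥ 1`). [cite: Mullner2017, §5.1] -/
theorem exists_uniform_enter [Finite σ] {k : ℕ} (hk : 1 ≤ k) {δ : σ → ℕ → σ} {F : Set σ}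
    (hF : ∀ q ∈ F, ∀ d, d < k → δ q d ∈ F)
    (hreach : ∀ q : σ, ∃ u : List ℕ, (∀ d ∈ u, d < k) ∧ u.foldl δ q ∈ F) :
    ∃ m : ℕ, ∀ q : σ, ∃ u : List ℕ, u.length = m ∧ (∀ d ∈ u, d < k) ∧ u.foldl δ q ∈ F := by
  classical
  haveI := Fintype.ofFinite σ
  choose u hu using hreach
  refine ⟨univ.sup fun q => (u q).length, fun q => ?_⟩
  set m := univ.sup fun q => (u q).length
  have hle : (u q).length ≤ m := le_sup (f := fun q => (u q).length) (mem_univ q)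
  refine ⟨u q ++ List.replicate (m - (u q).length) 0, ?_, ?_, ?_⟩
  · rw [List.length_append, List.length_replicate, Nat.add_sub_cancel' hle]
  · intro d hd
    rcases List.mem_append.1 hd with h | h
    · exact (hu q).1 d h
    · rw [List.eq_of_mem_replicate h]; exact hk
  · rw [List.foldl_append]
    refine foldl_mem_of_closed hF (fun d hd => ?_) (hu q).2
    rw [List.eq_of_mem_replicate hd]; exact hk

/-- **One more block costs a factor `k^m − 1`** (Müllner §5.1, the induction step of
eq. (number_paths_strongly_connected)): if every state enters the closed set `F` by a digit word
of length `m`, then `#enterBad(L + m) ≤ (k^m − 1) · #enterBad(L)`. [cite: Mullner2017, §5.1] -/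
theorem card_enterBad_add_le {k : ℕ} (hk : 1 < k) {δ : σ → ℕ → σ} {q₀ : σ} {F : Set σ}
    (hF : ∀ q ∈ F, ∀ d, d < k → δ q d ∈ F) {m : ℕ}
    (hm : ∀ q : σ, ∃ u : List ℕ, u.length = m ∧ (∀ d ∈ u, d < k) ∧ u.foldl δ q ∈ F) (L : ℕ) :
    (enterBad k δ q₀ F (L + m)).card ≤ (k ^ m - 1) * (enterBad k δ q₀ F L).card := by
  classical
  set K := k ^ m with hK
  have hKpos : 0 < K := pow_pos (by omega) m
  choose u hu using hm
  -- fibres of `b' ↦ b' / K` have at most `K - 1` elements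
  have himage : (enterBad k δ q₀ F (L + m)).image (fun b' => b' / K) ⊆ enterBad k δ q₀ F L := by
    intro b hb
    rw [mem_image] at hb
    obtain ⟨b', hb', rfl⟩ := hb
    rw [mem_enterBad] at hb' ⊢
    obtain ⟨hb'lt, hbad⟩ := hb'
    have hdiv : b' / K < k ^ L := by
      rw [Nat.div_lt_iff_lt_mul hKpos, ← pow_add]; exact hb'lt
    refine ⟨hdiv, fun hgood => hbad ?_⟩
    have hsplit : msbBlock k (L + m) b' = msbBlock k L (b' / K) ++ msbBlock k m (b' % K) := by
      conv_lhs => rw [← Nat.div_add_mod b' K]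
      exact msbBlock_add hk hdiv (Nat.mod_lt _ hKpos)
    rw [hsplit, List.foldl_append]
    exact foldl_mem_of_closed hF (fun d hd => lt_of_mem_msbBlock hk hd) hgood
  have hfib : ∀ b ∈ (enterBad k δ q₀ F (L + m)).image (fun b' => b' / K),
      ((enterBad k δ q₀ F (L + m)).filter fun b' => b' / K = b).card ≤ K - 1 := by
    intro b hb
    -- the state after the prefix `b`, and the code of its entering word
    set p := (msbBlock k L b).foldl δ q₀ with hp
    set c₀ := Nat.ofDigits k (u p).reverse with hc₀
    have hc₀K : c₀ < K := by
      have := Nat.ofDigits_lt_base_pow_length hk (l := (u p).reverse)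
        (fun d hd => (hu p).2.1 d (List.mem_reverse.1 hd))
      rwa [List.length_reverse, (hu p).1] at this
    have hc₀u : msbBlock k m c₀ = u p := by
      have := msbBlock_ofDigits_reverse hk (hu p).2.1
      rwa [(hu p).1] at this
    have hbK : b < k ^ L := (mem_enterBad.1 (himage hb)).1
    calc ((enterBad k δ q₀ F (L + m)).filter fun b' => b' / K = b).card
        ≤ (((range K).erase c₀).image fun c => K * b + c).card := by
          refine card_le_card fun b' hb' => ?_
          rw [mem_filter, mem_enterBad] at hb'
          obtain ⟨⟨hb'lt, hbad⟩, hdivb⟩ := hb'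
          rw [mem_image]
          refine ⟨b' % K, mem_erase.2 ⟨fun hc => hbad ?_, mem_range.2 (Nat.mod_lt _ hKpos)⟩, ?_⟩
          · have hsplit : msbBlock k (L + m) b' = msbBlock k L b ++ msbBlock k m c₀ := by
              conv_lhs => rw [← Nat.div_add_mod b' K, hdivb, hc]
              exact msbBlock_add hk hbK hc₀K
            rw [hsplit, List.foldl_append, hc₀u]
            exact (hu p).2.2
          · rw [← hdivb]; exact Nat.div_add_mod b' K
      _ ≤ ((range K).erase c₀).card := card_image_le
      _ = K - 1 := by rw [card_erase_of_mem (mem_range.2 hc₀K), card_range]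
  calc (enterBad k δ q₀ F (L + m)).card
      ≤ (K - 1) * ((enterBad k δ q₀ F (L + m)).image fun b' => b' / K).card :=
        card_le_mul_card_image _ _ hfib
    _ ≤ (K - 1) * (enterBad k δ q₀ F L).card := Nat.mul_le_mul_left _ (card_le_card himage)

/-- **Exponentially few prefixes miss the final states** (Müllner §5.1,
eq. (number_paths_strongly_connected): `#{w ∈ Σ^n : δ'(q', w) ∈ Q̃'} ≤ k^m k^{n(1−η)}`): with a
uniform entering length `m`, `#enterBad(m t) ≤ (k^m − 1)^t`. [cite: Mullner2017, §5.1] -/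
theorem card_enterBad_mul_le {k : ℕ} (hk : 1 < k) {δ : σ → ℕ → σ} {q₀ : σ} {F : Set σ}
    (hF : ∀ q ∈ F, ∀ d, d < k → δ q d ∈ F) {m : ℕ}
    (hm : ∀ q : σ, ∃ u : List ℕ, u.length = m ∧ (∀ d ∈ u, d < k) ∧ u.foldl δ q ∈ F) (t : ℕ) :
    (enterBad k δ q₀ F (m * t)).card ≤ (k ^ m - 1) ^ t := by
  induction t with
  | zero =>
    calc (enterBad k δ q₀ F (m * 0)).card ≤ (range (k ^ (m * 0))).card := by
          classical exact card_filter_le _ _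
      _ = (k ^ m - 1) ^ 0 := by simp
  | succ t ih =>
    rw [Nat.mul_succ, pow_succ, mul_comm ((k ^ m - 1) ^ t)]
    exact (card_enterBad_add_le hk hF hm (m * t)).trans (Nat.mul_le_mul_left _ ih)

end Enter

/-! ## Leading zeros -/

section Zeros

variable {σ : Type*}

/-- Reading zeros from a state fixed by `0` does nothing. [folklore] -/
theorem foldl_replicate_zero {δ : σ → ℕ → σ} {q₀ : σ} (h0 : δ q₀ 0 = q₀) (j : ℕ) :
    (List.replicate j 0).foldl δ q₀ = q₀ := by
  induction j with
  | zero => rfl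
  | succ j ih => rw [List.replicate_succ, List.foldl_cons, h0, ih]

/-- **Padded and unpadded readings agree** when `δ(q₀, 0) = q₀` (Müllner, Remark after Lemma
setDens: "the considered properties hold also for unreduced digital representations of `n`
(i.e., with leading zeros)"): `δ(q₀, (n)_k^ν) = δ(q₀, (n)_k)`. [cite: Mullner2017, §3.1] -/
theorem foldl_msbBlock_eq_of_fix_zero {δ : σ → ℕ → σ} {q₀ : σ} (h0 : δ q₀ 0 = q₀) (k ν n : ℕ) :
    (msbBlock k ν n).foldl δ q₀ = (Nat.digits k n).reverse.foldl δ q₀ := by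
  rw [msbBlock, Nat.digitsAppend, List.reverse_append, List.reverse_replicate, List.foldl_append,
    foldl_replicate_zero h0]

/-- The value of a DFAO sequence with `δ(q₀,0) = q₀` from the padded word. [folklore] -/
theorem dfaoSeq_eq_of_fix_zero {δ : σ → ℕ → σ} {q₀ : σ} (h0 : δ q₀ 0 = q₀) (k ν : ℕ)
    (τ : σ → ℂ) (n : ℕ) : dfaoSeq k δ q₀ τ n = τ ((msbBlock k ν n).foldl δ q₀) := by
  rw [dfaoSeq, foldl_msbBlock_eq_of_fix_zero h0]

/-- **Normalisation `δ(q₀, 0) = q₀`** (Allouche–Shallit Thm. 5.2.1; Müllner Cor. 2.26 arranges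
it): the automaton on `Option σ` with a fresh initial state `none` that loops on `0` and
otherwise moves like `q₀`. Transition function. [folklore] -/
def optionLiftδ (δ : σ → ℕ → σ) (q₀ : σ) : Option σ → ℕ → Option σ
  | none, d => if d = 0 then none else some (δ q₀ d)
  | some q, d => some (δ q d)

/-- Output function of the normalised automaton. [folklore] -/
def optionLiftτ (τ : σ → ℂ) (q₀ : σ) : Option σ → ℂ
  | none => τ q₀
  | some q => τ q

/-- Inside `some`, the lifted automaton is the old one. [folklore] -/
theorem foldl_optionLiftδ_some (δ : σ → ℕ → σ) (q₀ : σ) (l : List ℕ) (q : σ) :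
    l.foldl (optionLiftδ δ q₀) (some q) = some (l.foldl δ q) := by
  induction l generalizing q with
  | nil => rfl
  | cons d l ih => simp only [List.foldl_cons, optionLiftδ, ih]

/-- The lifted initial state is fixed by `0`. [folklore] -/
theorem optionLiftδ_none_zero (δ : σ → ℕ → σ) (q₀ : σ) : optionLiftδ δ q₀ none 0 = none := by
  simp [optionLiftδ]

/-- **The normalised automaton generates the same sequence** (the most significant digit of
`n ≥ 1` is non-zero, so the first step from `none` agrees with the step from `q₀`).
[folklore] -/
theorem dfaoSeq_optionLift (k : ℕ) (δ : σ → ℕ → σ) (q₀ : σ) (τ : σ → ℂ) :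
    dfaoSeq k (optionLiftδ δ q₀) none (optionLiftτ τ q₀) = dfaoSeq k δ q₀ τ := by
  funext n
  rcases Nat.eq_zero_or_pos n with rfl | hn
  · simp [dfaoSeq, optionLiftτ]
  · have hne : (Nat.digits k n).reverse ≠ [] := by
      simpa using Nat.digits_ne_nil_iff_ne_zero.2 hn.ne'
    obtain ⟨d, l, hdl⟩ := List.exists_cons_of_ne_nil hne
    have hd : d ≠ 0 := by
      have h1 := List.head_reverse hne
      have h2 : (Nat.digits k n).reverse.head hne = d := by simp [hdl]
      rw [h2] at h1
      rw [h1]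
      exact Nat.getLast_digit_ne_zero k hn.ne'
    simp only [dfaoSeq, hdl, List.foldl_cons, optionLiftδ, if_neg hd, foldl_optionLiftδ_some,
      optionLiftτ]

end Zeros

end Literature.NumberTheory.LFunctions
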